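import Summits.FinalStateConjecture.FinalStateConjecture.Theorems.EIHFluxBalanceInertialRecessionVirialSplit
import Summits.FinalStateConjecture.FinalStateConjecture.Theorems.EIHFluxBalanceInertialRecessionVirialNoReturn

/-!
# Route EIHFluxBalance — crux `InertialRecession`, abstract endgame:
# frozen velocities of isolated bodies, LEMMA SPLIT for `N ≤ 2`, the stub for `N ≤ 2`

Helper file for the crux `stmt-FinalStateConjecture-10166` (virial route, `InertialRecession_seat0_SPLIT_analysis.md` §3).
Mathlib-only.
* `abs_div_sub_div_le` — velocity components are Lipschitz in (energy, momentum);
* `velocity_frozen_of_isolated` — (general `N`) a body whose neighbours stay at distance `≥ ηs` on `[t₁, t₂]` changes its velocity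
  by at most `6(|C|·2(η/4)^{-3/2}t₁^{-1/2} + ζ(t₁) + ζ(t₂))/M` (single-body window of radius `ηs/4`,
  `Oracle.increment_of_windowPath`);
* `split_of_le_two` — LEMMA SPLIT for `N ≤ 2`: from the stub hypotheses, a pair is either linearly separated or sublinearly
  confined (the kinematic `no_return` lemma fed by `velocity_frozen_of_isolated` and slaving);
* `pairwiseDichotomy_of_le_two` — the conclusion of `stub_pairwiseDichotomy` for `N ≤ 2` (via `pairwiseDichotomy_of_split`).
-/

noncomputable section

open Finset Filter Topology MeasureTheory intervalIntegral

namespace Summit.FinalStateConjecture.FinalStateConjecture.Theorems.SublinearIsFree.Virial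

open Literature.Geometry.Lorentzian

variable {N : ℕ}

/-- Quotients `p/E` with `E ≥ m > 0`, `|p₁| ≤ E₁` are Lipschitz: `|p₂/E₂ − p₁/E₁| ≤ (|p₂ − p₁| + |E₂ − E₁|)/m`. [folklore] -/
theorem abs_div_sub_div_le {p₁ p₂ E₁ E₂ m : ℝ} (hm : 0 < m) (h1 : m ≤ E₁) (h2 : m ≤ E₂) (hp : |p₁| ≤ E₁) :
    |p₂ / E₂ - p₁ / E₁| ≤ (|p₂ - p₁| + |E₂ - E₁|) / m := by
  have hE₁ : 0 < E₁ := hm.trans_le h1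
  have hE₂ : 0 < E₂ := hm.trans_le h2
  have key : p₂ / E₂ - p₁ / E₁ = ((p₂ - p₁) * E₁ + p₁ * (E₁ - E₂)) / (E₁ * E₂) := by
    field_simp
    ring
  rw [key, abs_div, abs_of_pos (mul_pos hE₁ hE₂), div_le_div_iff₀ (mul_pos hE₁ hE₂) hm]
  have h3 : |(p₂ - p₁) * E₁ + p₁ * (E₁ - E₂)| ≤ |p₂ - p₁| * E₁ + E₁ * |E₂ - E₁| := by
    calc |(p₂ - p₁) * E₁ + p₁ * (E₁ - E₂)| ≤ |(p₂ - p₁) * E₁| + |p₁ * (E₁ - E₂)| := abs_add_le _ _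
      _ = |p₂ - p₁| * E₁ + |p₁| * |E₂ - E₁| := by
          rw [abs_mul, abs_mul, abs_of_pos hE₁, abs_sub_comm E₁ E₂]
      _ ≤ |p₂ - p₁| * E₁ + E₁ * |E₂ - E₁| := by
          have := mul_le_mul_of_nonneg_right hp (abs_nonneg (E₂ - E₁))
          linarith
  have h4 : (|p₂ - p₁| * E₁ + E₁ * |E₂ - E₁|) * m ≤ (|p₂ - p₁| + |E₂ - E₁|) * (E₁ * E₂) := by
    have h5 : (|p₂ - p₁| * E₁ + E₁ * |E₂ - E₁|) * m = (|p₂ - p₁| + |E₂ - E₁|) * (E₁ * m) := by ring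
    rw [h5]
    exact mul_le_mul_of_nonneg_left (mul_le_mul_of_nonneg_left h2 hE₁.le) (by positivity)
  exact (mul_le_mul_of_nonneg_right h3 hm.le).trans h4

/-- **Frozen velocity of an isolated body** (general `N`, see the module docstring). Instances of the window law (`C`, after
`T`) and identification (`ζ`, after `T'`) at threshold `ρ` and clearance `1/2`, speeds `≤ 2` after `T₀`; on `[t₁, t₂]` all
other bodies stay `≥ ηs` away from `x`, `ρ ≤ ηs/8`, and the window `(ξₓ, ηs/4)` fits the cone. [folklore] -/
theorem velocity_frozen_of_isolated (M : Fin N → ℝ) (ξ v : Fin N → ℝ → E3) (κ : ℝ) (P : ℝ → E3 → ℝ → Fin 4 → ℝ)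
    (ρ : ℝ → ℝ) (C T T' T₀ : ℝ) (ζ : ℝ → ℝ)
    (hWL : ∀ (t₁ t₂ : ℝ) (c : ℝ → E3) (R : ℝ → ℝ), T ≤ t₁ → t₁ ≤ t₂ →
      (∀ s ∈ Set.Icc t₁ t₂, ∀ s' ∈ Set.Icc t₁ t₂, ‖c s - c s'‖ ≤ 2 * |s - s'| ∧ |R s - R s'| ≤ 2 * |s - s'|) →
      (∀ s ∈ Set.Icc t₁ t₂, ρ s ≤ (1 / 2) * R s ∧ ‖c s‖ + R s ≤ (κ + κ ^ 2) / 2 * s ∧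
        ∀ j, ‖ξ j s - c s‖ ≤ (1 - 1 / 2) * R s ∨ (1 + 1 / 2) * R s ≤ ‖ξ j s - c s‖) →
      ∀ μ : Fin 4, |P t₂ (c t₂) (R t₂) μ - P t₁ (c t₁) (R t₁) μ| ≤ C * ∫ s in t₁..t₂, (R s ^ (3 / 2 : ℝ))⁻¹)
    (hID : ∀ (t : ℝ) (c : E3) (R : ℝ) (A : Finset (Fin N)), T' ≤ t → ρ t ≤ (1 / 2) * R →
      ‖c‖ + R ≤ (κ + κ ^ 2) / 2 * t →
      (∀ j, ‖ξ j t - c‖ ≤ (1 - 1 / 2) * R ∨ (1 + 1 / 2) * R ≤ ‖ξ j t - c‖) →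
      (∀ j, j ∈ A ↔ ‖ξ j t - c‖ ≤ (1 - 1 / 2) * R) →
      |P t c R 0 - ∑ j ∈ A, M j * (√(1 - ‖v j t‖ ^ 2))⁻¹| ≤ ζ t ∧
      ∀ k : Fin 3, |P t c R k.succ - ∑ j ∈ A, M j * (√(1 - ‖v j t‖ ^ 2))⁻¹ * v j t k| ≤ ζ t)
    (hdiff : ∀ i, Differentiable ℝ (ξ i)) (hspeed : ∀ i s, T₀ ≤ s → ‖deriv (ξ i) s‖ ≤ 2)
    {x : Fin N} (hM : 0 < M x) (hv1 : ∀ t, ‖v x t‖ < 1)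
    {t₁ t₂ η : ℝ} (hη : 0 < η) (hη8 : η ≤ 8) (hT : T ≤ t₁) (hT' : T' ≤ t₁) (hT₀ : T₀ ≤ t₁) (ht₁ : 0 < t₁)
    (h12 : t₁ ≤ t₂) (hρ : ∀ s ∈ Set.Icc t₁ t₂, ρ s ≤ η * s / 8)
    (hcap : ∀ s ∈ Set.Icc t₁ t₂, ‖ξ x s‖ + η / 4 * s ≤ (κ + κ ^ 2) / 2 * s)
    (hiso : ∀ s ∈ Set.Icc t₁ t₂, ∀ j, j ≠ x → η * s ≤ ‖ξ j s - ξ x s‖) :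
    ‖v x t₂ - v x t₁‖ ≤
      6 * (|C| * (2 * ((η / 4) ^ (3 / 2 : ℝ))⁻¹ * (t₁ ^ (1 / 2 : ℝ))⁻¹) + ζ t₁ + ζ t₂) / M x := by
  classical
  have hη4 : 0 < η / 4 := by positivity
  -- the single-body window `(ξ x, η s / 4)`
  have hinc := Oracle.increment_of_windowPath M ξ v κ P ρ C T T' T₀ ζ hWL hID hdiff hspeed (A := {x}) (a := x)
    (t₁ := t₁) (t₂ := t₂) (R := fun s ↦ η / 4 * s) hT hT' hT₀ h12
    (fun s _ s' _ ↦ by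
      show |η / 4 * s - η / 4 * s'| ≤ 2 * |s - s'|
      rw [← mul_sub, abs_mul, abs_of_pos hη4]
      exact mul_le_mul_of_nonneg_right (by linarith) (abs_nonneg _))
    (fun s hs ↦ mul_pos hη4 (ht₁.trans_le hs.1))
    (fun s hs ↦ by have := hρ s hs; show ρ s ≤ η / 4 * s / 2; linarith)
    hcap
    (fun s hs i hi ↦ by
      rw [Finset.mem_singleton.mp hi, sub_self, norm_zero]
      have := ht₁.trans_le hs.1
      positivity)
    (fun s hs j hj ↦ by
      have h := hiso s hs j (fun h ↦ hj (Finset.mem_singleton.mpr h))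
      show 3 * (η / 4 * s) / 2 ≤ ‖ξ j s - ξ x s‖
      have := ht₁.trans_le hs.1
      nlinarith)
  simp only [Finset.sum_singleton] at hinc
  -- the budget
  have hint : ∫ s in t₁..t₂, ((η / 4 * s) ^ (3 / 2 : ℝ))⁻¹ ≤ 2 * ((η / 4) ^ (3 / 2 : ℝ))⁻¹ * (t₁ ^ (1 / 2 : ℝ))⁻¹ :=
    Endgame.integral_inv_rpow_three_halves_mul_le hη4 ht₁ h12
  have hint0 : 0 ≤ ∫ s in t₁..t₂, ((η / 4 * s) ^ (3 / 2 : ℝ))⁻¹ :=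
    intervalIntegral.integral_nonneg h12 fun s hs ↦
      (inv_pos.mpr (Real.rpow_pos_of_pos (mul_pos hη4 (ht₁.trans_le hs.1)) _)).le
  set Bd : ℝ := |C| * (2 * ((η / 4) ^ (3 / 2 : ℝ))⁻¹ * (t₁ ^ (1 / 2 : ℝ))⁻¹) + ζ t₁ + ζ t₂ with hBd
  have hCle : C * (∫ s in t₁..t₂, ((η / 4 * s) ^ (3 / 2 : ℝ))⁻¹) + ζ t₁ + ζ t₂ ≤ Bd := by
    have h1 : C * (∫ s in t₁..t₂, ((η / 4 * s) ^ (3 / 2 : ℝ))⁻¹) ≤ |C| * ∫ s in t₁..t₂, ((η / 4 * s) ^ (3 / 2 : ℝ))⁻¹ :=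
      mul_le_mul_of_nonneg_right (le_abs_self C) hint0
    have h2 := mul_le_mul_of_nonneg_left hint (abs_nonneg C)
    rw [hBd]; linarith
  have hE : |M x * (√(1 - ‖v x t₂‖ ^ 2))⁻¹ - M x * (√(1 - ‖v x t₁‖ ^ 2))⁻¹| ≤ Bd := hinc.1.trans hCle
  have hP : ∀ k : Fin 3, |M x * (√(1 - ‖v x t₂‖ ^ 2))⁻¹ * v x t₂ k - M x * (√(1 - ‖v x t₁‖ ^ 2))⁻¹ * v x t₁ k| ≤ Bd :=
    fun k ↦ (hinc.2 k).trans hCle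
  -- energies are at least `M x`
  have hγ : ∀ t, 1 ≤ (√(1 - ‖v x t‖ ^ 2))⁻¹ := fun t ↦ Endgame.one_le_inv_sqrt_one_sub_sq (hv1 t)
  have hEge : ∀ t, M x ≤ M x * (√(1 - ‖v x t‖ ^ 2))⁻¹ := fun t ↦ le_mul_of_one_le_right hM.le (hγ t)
  have hEpos : ∀ t, 0 < M x * (√(1 - ‖v x t‖ ^ 2))⁻¹ := fun t ↦ hM.trans_le (hEge t)
  -- componentwise velocity change
  have hcomp : ∀ k : Fin 3, |v x t₂ k - v x t₁ k| ≤ 2 * Bd / M x := by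
    intro k
    have hvk : ∀ t, |v x t k| ≤ 1 := fun t ↦ by
      have h1 : ‖v x t k‖ ≤ ‖v x t‖ := PiLp.norm_apply_le (v x t) k
      rw [Real.norm_eq_abs] at h1
      exact h1.trans (hv1 t).le
    have hp₁ : |M x * (√(1 - ‖v x t₁‖ ^ 2))⁻¹ * v x t₁ k| ≤ M x * (√(1 - ‖v x t₁‖ ^ 2))⁻¹ := by
      rw [abs_mul, abs_of_pos (hEpos t₁)]
      exact mul_le_of_le_one_right (hEpos t₁).le (hvk t₁)
    have h := abs_div_sub_div_le (p₁ := M x * (√(1 - ‖v x t₁‖ ^ 2))⁻¹ * v x t₁ k)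
      (p₂ := M x * (√(1 - ‖v x t₂‖ ^ 2))⁻¹ * v x t₂ k) hM (hEge t₁) (hEge t₂) hp₁
    rw [mul_div_cancel_left₀ _ (hEpos t₂).ne', mul_div_cancel_left₀ _ (hEpos t₁).ne'] at h
    refine h.trans ?_
    rw [div_le_div_iff_of_pos_right hM]
    linarith [hP k, hE]
  -- the vector
  calc ‖v x t₂ - v x t₁‖ ≤ ∑ k, |(v x t₂ - v x t₁) k| := Endgame.norm_le_sum_abs _
    _ ≤ ∑ _k : Fin 3, 2 * Bd / M x := Finset.sum_le_sum fun k _ ↦ by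
        rw [PiLp.sub_apply]; exact hcomp k
    _ = 6 * Bd / M x := by simp; ring

set_option maxHeartbeats 400000 in
/-- **LEMMA SPLIT for a linearly isolated pair.** Under the hypotheses of `stub_pairwiseDichotomy`, a pair `{i, j}` from which
every other body stays linearly far is either linearly separated or sublinearly confined: if the pair is not confined it is seen
at linear scale `s₀t` frequently; between entries into `{d ≥ θs}` both bodies are `θs`-isolated, so their velocities are frozen
(`velocity_frozen_of_isolated`) and the relative position has a frozen derivative (slaving); the kinematic `no_return` lemma then
keeps `d ≥ θt` forever. [folklore] -/
theorem split_of_isolated_pair (M : Fin N → ℝ) (ξ v : Fin N → ℝ → E3) (κ : ℝ)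
    (P : ℝ → E3 → ℝ → Fin 4 → ℝ) (hM : ∀ i, 0 < M i) (hκ0 : 0 < κ) (hκ1 : κ < 1)
    (hξ : ∀ i, ContDiff ℝ ((⊤ : ℕ∞) : WithTop ℕ∞) (ξ i))
    (hcone : ∀ i, ∀ᶠ t in atTop, ‖ξ i t‖ ≤ κ ^ 2 * t)
    (_hsep : ∀ i j, i ≠ j → Tendsto (fun t ↦ ‖ξ i t - ξ j t‖) atTop atTop) (_hvc : ∀ i, Continuous (v i))
    (hk : ∃ k : ℝ, 0 ≤ k ∧ k < 1 ∧ ∀ i t, ‖v i t‖ ≤ k)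
    (hslave : ∀ i, Tendsto (fun t ↦ deriv (ξ i) t - v i t) atTop (𝓝 0))
    (hWL : ∀ ρ : ℝ → ℝ, Tendsto ρ atTop atTop → ∀ δ : ℝ, 0 < δ → δ < 1 → ∃ (C T : ℝ),
      ∀ (t₁ t₂ : ℝ) (c : ℝ → E3) (R : ℝ → ℝ), T ≤ t₁ → t₁ ≤ t₂ →
      (∀ s ∈ Set.Icc t₁ t₂, ∀ s' ∈ Set.Icc t₁ t₂, ‖c s - c s'‖ ≤ 2 * |s - s'| ∧ |R s - R s'| ≤ 2 * |s - s'|) →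
      (∀ s ∈ Set.Icc t₁ t₂, ρ s ≤ δ * R s ∧ ‖c s‖ + R s ≤ (κ + κ ^ 2) / 2 * s ∧
        ∀ j, ‖ξ j s - c s‖ ≤ (1 - δ) * R s ∨ (1 + δ) * R s ≤ ‖ξ j s - c s‖) →
      ∀ μ : Fin 4, |P t₂ (c t₂) (R t₂) μ - P t₁ (c t₁) (R t₁) μ| ≤ C * ∫ s in t₁..t₂, (R s ^ (3 / 2 : ℝ))⁻¹)
    (hID : ∀ ρ : ℝ → ℝ, Tendsto ρ atTop atTop → ∀ δ : ℝ, 0 < δ → δ < 1 → ∃ (T : ℝ) (ζ : ℝ → ℝ),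
      Tendsto ζ atTop (𝓝 0) ∧ ∀ (t : ℝ) (c : E3) (R : ℝ) (A : Finset (Fin N)), T ≤ t → ρ t ≤ δ * R →
      ‖c‖ + R ≤ (κ + κ ^ 2) / 2 * t → (∀ j, ‖ξ j t - c‖ ≤ (1 - δ) * R ∨ (1 + δ) * R ≤ ‖ξ j t - c‖) →
      (∀ j, j ∈ A ↔ ‖ξ j t - c‖ ≤ (1 - δ) * R) →
      |P t c R 0 - ∑ j ∈ A, M j * (√(1 - ‖v j t‖ ^ 2))⁻¹| ≤ ζ t ∧
      ∀ k : Fin 3, |P t c R k.succ - ∑ j ∈ A, M j * (√(1 - ‖v j t‖ ^ 2))⁻¹ * v j t k| ≤ ζ t)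
    (i j : Fin N) {σ : ℝ} (hσ : 0 < σ)
    (hrest : ∀ᶠ t in atTop, ∀ x ∈ ({i, j} : Finset (Fin N)), ∀ z ∉ ({i, j} : Finset (Fin N)), σ * t ≤ ‖ξ z t - ξ x t‖) :
    (∃ σ' : ℝ, 0 < σ' ∧ ∀ᶠ t in atTop, σ' * t ≤ ‖ξ j t - ξ i t‖) ∨
      ∀ η : ℝ, 0 < η → ∀ᶠ t in atTop, ‖ξ j t - ξ i t‖ ≤ η * t := by
  classical
  by_cases hij : i = j
  · right
    intro η hη
    subst hij
    filter_upwards [eventually_ge_atTop 0] with t ht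
    rw [sub_self, norm_zero]
    positivity
  by_cases hconf : ∀ η : ℝ, 0 < η → ∀ᶠ t in atTop, ‖ξ j t - ξ i t‖ ≤ η * t
  · exact Or.inr hconf
  left
  push Not at hconf
  obtain ⟨s₀, hs₀, hfreq⟩ := hconf
  -- data
  obtain ⟨k, hk0, hk1, hvk⟩ := id hk
  have hv1 : ∀ x t, ‖v x t‖ < 1 := fun x t ↦ (hvk x t).trans_lt hk1
  have hdiff : ∀ x, Differentiable ℝ (ξ x) := fun x ↦ (hξ x).differentiable (by simp)
  have hMm : 0 < min (M i) (M j) := lt_min (hM i) (hM j)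
  -- the window law and the identification at `ρ = √t`, `δ = 1/2`
  have hρ : Tendsto (fun t : ℝ ↦ √t) atTop atTop := by
    have := tendsto_rpow_atTop (show (0 : ℝ) < 1 / 2 by norm_num)
    refine this.congr' ?_
    filter_upwards [eventually_ge_atTop 0] with t ht
    rw [Real.sqrt_eq_rpow]
  obtain ⟨C, T_W, hW⟩ := hWL (fun t ↦ √t) hρ (1 / 2) (by norm_num) (by norm_num)
  obtain ⟨T_I, ζ, hζ, hI⟩ := hID (fun t ↦ √t) hρ (1 / 2) (by norm_num) (by norm_num)
  -- envelopes of `ζ` and of the slaving error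
  obtain ⟨Fζ, hFζa, hFζ0, hFζnn, -, Tz, hTz0, hFζdom⟩ := exists_capped_envelope hζ
  have he0 : Tendsto (fun u ↦ ∑ x, ‖deriv (ξ x) u - v x u‖) atTop (𝓝 0) := by
    simpa using tendsto_finsetSum (univ : Finset (Fin N)) fun x _ ↦ (hslave x).norm
  obtain ⟨Fe, hFea, hFe0, hFenn, -, Tv, hTv0, hFedom⟩ := exists_capped_envelope he0
  -- the constants `θ = η = e`, `B`, `K`
  have hκκ : 0 < κ - κ ^ 2 := by nlinarith only [hκ0, hκ1]
  obtain ⟨θ, hθdef⟩ : ∃ θ : ℝ, θ = min (min (s₀ / 16) (s₀ ^ 2 / 100)) (min (min (2 * (κ - κ ^ 2)) 1) (σ / 2)) :=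
    ⟨_, rfl⟩
  have hθ0 : 0 < θ := by
    rw [hθdef]
    exact lt_min (lt_min (by positivity) (by positivity)) (lt_min (lt_min (by linarith only [hκκ]) one_pos) (by positivity))
  have hθs : θ ≤ s₀ / 16 := hθdef ▸ (min_le_left _ _).trans (min_le_left _ _)
  have hθs2 : θ ≤ s₀ ^ 2 / 100 := hθdef ▸ (min_le_left _ _).trans (min_le_right _ _)
  have hθκ : θ ≤ 2 * (κ - κ ^ 2) := hθdef ▸ (min_le_right _ _).trans ((min_le_left _ _).trans (min_le_left _ _))
  have hθ1 : θ ≤ 1 := hθdef ▸ (min_le_right _ _).trans ((min_le_left _ _).trans (min_le_right _ _))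
  have hθσ : θ ≤ σ / 2 := hθdef ▸ (min_le_right _ _).trans (min_le_right _ _)
  obtain ⟨B, hBdef⟩ : ∃ B : ℝ, B = 2 * κ ^ 2 := ⟨_, rfl⟩
  have hB0 : 0 ≤ B := by rw [hBdef]; positivity
  obtain ⟨K, hKdef⟩ : ∃ K : ℝ, K = max 2 (B / θ) := ⟨_, rfl⟩
  have hK2 : 2 ≤ K := hKdef ▸ le_max_left _ _
  have hK0 : 0 < K := by linarith only [hK2]
  have hBK : B / K ≤ θ := by
    rw [div_le_iff₀ hK0]
    calc B = θ * (B / θ) := by field_simp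
      _ ≤ θ * K := mul_le_mul_of_nonneg_left (hKdef ▸ le_max_right _ _) hθ0.le
  have hBK0 : 0 ≤ B / K := by positivity
  -- smallness for `no_return`
  have h1 : 2 * θ ≤ s₀ / 2 - (θ + B / K) - 2 * θ := by linarith only [hBK, hθs, hθ0.le]
  have h2 : 2 * θ + (θ + B / K) ≤ (s₀ / 2 - (θ + B / K) - 2 * θ) * ((s₀ / 2 - (θ + B / K)) / 2) := by
    have f1 : s₀ / 4 ≤ s₀ / 2 - (θ + B / K) - 2 * θ := by linarith only [hBK, hθs]
    have f2 : 3 * s₀ / 8 ≤ s₀ / 2 - (θ + B / K) := by linarith only [hBK, hθs]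
    have f3 : s₀ / 4 * (3 * s₀ / 8 / 2) ≤ (s₀ / 2 - (θ + B / K) - 2 * θ) * ((s₀ / 2 - (θ + B / K)) / 2) :=
      mul_le_mul f1 (by linarith only [f2]) (by positivity) (by linarith only [f1, hs₀])
    linarith only [f3, hBK, hθs2, sq_nonneg s₀, hθ0.le]
  -- thresholds
  have hc0 : 0 < min (1 - k) (θ / 8) := lt_min (by linarith only [hk1]) (by positivity)
  obtain ⟨T_fe, hTfe⟩ := (hFe0.eventually (eventually_le_nhds hc0)).exists_forall_of_atTop
  have hbud0 : 0 < θ * min (M i) (M j) / 48 := by positivity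
  have hlim1 : Tendsto (fun a : ℝ ↦ |C| * (2 * ((θ / 4) ^ (3 / 2 : ℝ))⁻¹ * (a ^ (1 / 2 : ℝ))⁻¹)) atTop (𝓝 0) := by
    simpa [mul_assoc] using (Endgame.tendsto_inv_rpow_half.const_mul (2 * ((θ / 4) ^ (3 / 2 : ℝ))⁻¹)).const_mul |C|
  obtain ⟨T_c1, hTc1⟩ := (hlim1.eventually (eventually_le_nhds hbud0)).exists_forall_of_atTop
  obtain ⟨T_c2, hTc2⟩ := (hFζ0.eventually (eventually_le_nhds hbud0)).exists_forall_of_atTop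
  obtain ⟨T_cone, hTcone⟩ := (Filter.eventually_all.mpr hcone).exists_forall_of_atTop
  obtain ⟨T_rest, hTrest⟩ := hrest.exists_forall_of_atTop
  obtain ⟨T₀, hT₀def⟩ : ∃ T₀ : ℝ, T₀ = max (max (max (max T_W T_I) (max Tz Tv)) (max (max T_fe T_c1) (max T_c2 T_cone)))
      (max (max 1 T_rest) (64 / θ ^ 2)) := ⟨_, rfl⟩
  have h0W : T_W ≤ T₀ := by rw [hT₀def]; simp
  have h0I : T_I ≤ T₀ := by rw [hT₀def]; simp
  have h0z : Tz ≤ T₀ := by rw [hT₀def]; simp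
  have h0v : Tv ≤ T₀ := by rw [hT₀def]; simp
  have h0fe : T_fe ≤ T₀ := by rw [hT₀def]; simp
  have h0c1 : T_c1 ≤ T₀ := by rw [hT₀def]; simp
  have h0c2 : T_c2 ≤ T₀ := by rw [hT₀def]; simp
  have h0cone : T_cone ≤ T₀ := by rw [hT₀def]; simp
  have h01 : 1 ≤ T₀ := by rw [hT₀def]; simp
  have h0rest : T_rest ≤ T₀ := by rw [hT₀def]; simp
  have h0θ : 64 / θ ^ 2 ≤ T₀ := by rw [hT₀def]; simp
  have hT₀pos : 0 < T₀ := one_pos.trans_le h01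
  -- pointwise facts after `T₀`
  have hslave1 : ∀ x s, T₀ ≤ s → ‖deriv (ξ x) s - v x s‖ ≤ min (1 - k) (θ / 8) := by
    intro x s hs
    have h1 : ‖deriv (ξ x) s - v x s‖ ≤ ∑ y, ‖deriv (ξ y) s - v y s‖ :=
      Finset.single_le_sum (f := fun y ↦ ‖deriv (ξ y) s - v y s‖) (fun _ _ ↦ norm_nonneg _) (mem_univ x)
    exact (h1.trans (hFedom T₀ h0v s T₀ hs (by linarith only [hs, hT₀pos]))).trans (hTfe T₀ h0fe)
  have hspeed1 : ∀ x s, T₀ ≤ s → ‖deriv (ξ x) s‖ ≤ 1 := by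
    intro x s hs
    have h1 := hslave1 x s hs
    have h2 := min_le_left (1 - k) (θ / 8)
    calc ‖deriv (ξ x) s‖ = ‖(deriv (ξ x) s - v x s) + v x s‖ := by rw [sub_add_cancel]
      _ ≤ ‖deriv (ξ x) s - v x s‖ + ‖v x s‖ := norm_add_le _ _
      _ ≤ 1 := by linarith only [h1, h2, hvk x s]
  have hspeed2 : ∀ x s, T₀ ≤ s → ‖deriv (ξ x) s‖ ≤ 2 := fun x s hs ↦ (hspeed1 x s hs).trans (by norm_num)
  have hconeT : ∀ s, T₀ ≤ s → ∀ x, ‖ξ x s‖ ≤ κ ^ 2 * s := fun s hs x ↦ hTcone s (h0cone.trans hs) x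
  have hrestT : ∀ s, T₀ ≤ s → ∀ y, y ≠ i → y ≠ j → θ * s ≤ ‖ξ y s - ξ i s‖ ∧ θ * s ≤ ‖ξ y s - ξ j s‖ := by
    intro s hs y hyi hyj
    have hy : y ∉ ({i, j} : Finset (Fin N)) := by simp [hyi, hyj]
    have hs0 : 0 ≤ s := by linarith only [hs, hT₀pos]
    have hq : θ * s ≤ σ * s := mul_le_mul_of_nonneg_right (by linarith only [hθσ, hσ]) hs0
    exact ⟨hq.trans (hTrest s (h0rest.trans hs) i (by simp) y hy), hq.trans (hTrest s (h0rest.trans hs) j (by simp) y hy)⟩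
  have hsqrt : ∀ s, T₀ ≤ s → √s ≤ θ * s / 8 := by
    intro s hs
    have hs0 : 0 ≤ s := by linarith only [hs, hT₀pos]
    have hθ2 : 0 < θ ^ 2 := by positivity
    have h64 : 64 ≤ θ ^ 2 * s := by
      have h64' := (div_le_iff₀ hθ2).mp (h0θ.trans hs)
      linarith only [h64']
    have hy : 0 ≤ θ * s / 8 := by positivity
    have hle : s ≤ (θ * s / 8) ^ 2 := by nlinarith only [h64, hs0]
    calc √s ≤ √((θ * s / 8) ^ 2) := Real.sqrt_le_sqrt hle
      _ = θ * s / 8 := Real.sqrt_sq hy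
  -- frozen velocity of a `θ`-isolated body on `[a, s]`
  have hfro : ∀ (x : Fin N) (a s : ℝ), x = i ∨ x = j → T₀ ≤ a → a ≤ s →
      (∀ s' ∈ Set.Icc a s, ∀ y, y ≠ x → θ * s' ≤ ‖ξ y s' - ξ x s'‖) → ‖v x s - v x a‖ ≤ 3 * θ / 8 := by
    intro x a s hx ha has hiso
    have ha0 : 0 < a := hT₀pos.trans_le ha
    have hMx : min (M i) (M j) ≤ M x := by
      rcases hx with rfl | rfl
      · exact min_le_left _ _
      · exact min_le_right _ _
    have h := velocity_frozen_of_isolated M ξ v κ P (fun t ↦ √t) C T_W T_I T₀ ζ hW hI hdiff hspeed2 (hM x) (hv1 x)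
      hθ0 (by linarith only [hθ1]) (h0W.trans ha) (h0I.trans ha) ha ha0 has
      (fun s' hs' ↦ hsqrt s' (ha.trans hs'.1))
      (fun s' hs' ↦ by
        have hc := hconeT s' (ha.trans hs'.1) x
        have hs'0 : 0 ≤ s' := by linarith only [hs'.1, ha, hT₀pos]
        have hq : θ / 4 * s' ≤ (κ - κ ^ 2) / 2 * s' := mul_le_mul_of_nonneg_right (by linarith only [hθκ]) hs'0
        linarith only [hc, hq])
      hiso
    -- the budget is at most `θ M_min / 16`
    have hb1 := hTc1 a (h0c1.trans ha)
    have hb2 : ζ a ≤ θ * min (M i) (M j) / 48 :=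
      (hFζdom T₀ h0z a a ha (by linarith only [ha0])).trans (hTc2 a (h0c2.trans ha))
    have hb3 : ζ s ≤ θ * min (M i) (M j) / 48 :=
      (hFζdom T₀ h0z s a (ha.trans has) (by linarith only [ha0, has])).trans (hTc2 a (h0c2.trans ha))
    have hBd : |C| * (2 * ((θ / 4) ^ (3 / 2 : ℝ))⁻¹ * (a ^ (1 / 2 : ℝ))⁻¹) + ζ a + ζ s ≤ θ * min (M i) (M j) / 16 := by
      linarith only [hb1, hb2, hb3]
    refine h.trans ?_
    rw [div_le_iff₀ (hM x)]
    have hq : θ * min (M i) (M j) ≤ θ * M x := mul_le_mul_of_nonneg_left hMx hθ0.le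
    calc 6 * (|C| * (2 * ((θ / 4) ^ (3 / 2 : ℝ))⁻¹ * (a ^ (1 / 2 : ℝ))⁻¹) + ζ a + ζ s)
        ≤ 6 * (θ * min (M i) (M j) / 16) := by linarith only [hBd]
      _ ≤ 3 * θ / 8 * M x := by linarith only [hq]
  -- the relative position
  obtain ⟨D, hDdef⟩ : ∃ D : ℝ → E3, D = fun t ↦ ξ j t - ξ i t := ⟨_, rfl⟩
  have hD : Differentiable ℝ D := by rw [hDdef]; exact (hdiff j).sub (hdiff i)
  have hDap : ∀ t, D t = ξ j t - ξ i t := fun t ↦ by rw [hDdef]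
  have hDder : ∀ t, deriv D t = deriv (ξ j) t - deriv (ξ i) t := fun t ↦ by
    rw [hDdef]; exact deriv_sub (hdiff j t) (hdiff i t)
  have hspeedD : ∀ s, T₀ ≤ s → ‖deriv D s‖ ≤ 2 := fun s hs ↦ by
    rw [hDder]
    exact (norm_sub_le _ _).trans (by linarith only [hspeed1 j s hs, hspeed1 i s hs])
  have hboundD : ∀ s, T₀ ≤ s → ‖D s‖ ≤ B * s := fun s hs ↦ by
    rw [hDap, hBdef]
    exact (norm_sub_le _ _).trans (by linarith only [hconeT s hs j, hconeT s hs i])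
  have hfrozen : ∀ a b : ℝ, T₀ ≤ a → a ≤ b → (∀ s ∈ Set.Icc a b, θ * s ≤ ‖D s‖) →
      ∃ W : E3, ∀ s ∈ Set.Icc a b, ‖deriv D s - W‖ ≤ θ := by
    intro a b ha hab hfar
    refine ⟨v j a - v i a, fun s hs ↦ ?_⟩
    have hisoi : ∀ s' ∈ Set.Icc a s, ∀ y, y ≠ i → θ * s' ≤ ‖ξ y s' - ξ i s'‖ := by
      intro s' hs' y hy
      by_cases hyj : y = j
      · rw [hyj]; have := hfar s' ⟨hs'.1, hs'.2.trans hs.2⟩; rwa [hDap] at this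
      · exact (hrestT s' (ha.trans hs'.1) y hy hyj).1
    have hisoj : ∀ s' ∈ Set.Icc a s, ∀ y, y ≠ j → θ * s' ≤ ‖ξ y s' - ξ j s'‖ := by
      intro s' hs' y hy
      by_cases hyi : y = i
      · rw [hyi]; have := hfar s' ⟨hs'.1, hs'.2.trans hs.2⟩; rwa [hDap, norm_sub_rev] at this
      · exact (hrestT s' (ha.trans hs'.1) y hyi hy).2
    have hvi := hfro i a s (Or.inl rfl) ha hs.1 hisoi
    have hvj := hfro j a s (Or.inr rfl) ha hs.1 hisoj
    have hsi := hslave1 i s (ha.trans hs.1)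
    have hsj := hslave1 j s (ha.trans hs.1)
    have hm := min_le_right (1 - k) (θ / 8)
    calc ‖deriv D s - (v j a - v i a)‖
        = ‖(deriv (ξ j) s - v j s) - (deriv (ξ i) s - v i s) + (v j s - v j a) - (v i s - v i a)‖ := by
          rw [hDder]; congr 1; abel
      _ ≤ ‖deriv (ξ j) s - v j s‖ + ‖deriv (ξ i) s - v i s‖ + ‖v j s - v j a‖ + ‖v i s - v i a‖ := by
          refine (norm_sub_le _ _).trans ?_
          refine add_le_add ((norm_add_le _ _).trans (add_le_add (norm_sub_le _ _) le_rfl)) le_rfl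
      _ ≤ θ := by linarith only [hvi, hvj, hsi, hsj, hm]
  -- a late time at which the pair is seen at scale `s₀ t`
  obtain ⟨t₀, ht₀, hbig⟩ := hfreq.forall_exists_of_atTop (K * T₀)
  have ht₀0 : 0 < t₀ := lt_of_lt_of_le (by positivity) ht₀
  have hbig' : s₀ * t₀ / 2 ≤ ‖D t₀‖ := by
    rw [hDap]
    have hlt : s₀ * t₀ < ‖ξ j t₀ - ξ i t₀‖ := hbig
    nlinarith only [hlt, hs₀, ht₀0]
  have hnr := no_return hD hT₀pos hK2 hθ0 hθ0.le hB0 hspeedD hboundD hfrozen h1 h2 ht₀ hbig'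
  refine ⟨θ, hθ0, ?_⟩
  filter_upwards [eventually_ge_atTop t₀] with t ht
  rw [← hDap]
  exact hnr t ht

/-- Registered one-line form of `abs_div_sub_div_le`. [folklore] -/
theorem abs_div_sub_div_le' : ∀ {p₁ p₂ E₁ E₂ m : ℝ}, 0 < m → m ≤ E₁ → m ≤ E₂ → |p₁| ≤ E₁ → |p₂ / E₂ - p₁ / E₁| ≤ (|p₂ - p₁| + |E₂ - E₁|) / m :=
  fun hm h1 h2 hp ↦ abs_div_sub_div_le hm h1 h2 hp

end Summit.FinalStateConjecture.FinalStateConjecture.Theorems.SublinearIsFree.Virial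

end
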